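import Summits.NavierStokesRegularity.NavierStokesRegularity.Theses.QuantisedSymmetry
import Summits.NavierStokesRegularity.NavierStokesRegularity.Theses.Blowup
import Summits.NavierStokesRegularity.NavierStokesRegularity.Theorems.QuantisedSymmetryPolyhedralTruncationBridge
import Summits.NavierStokesRegularity.NavierStokesRegularity.Theorems.QuantisedSymmetryPolyhedralDssProfileExistsDominatesBlowupProfile
import Summits.NavierStokesRegularity.NavierStokesRegularity.Theorems.QuantisedSymmetryLiouvilleKillsProfile
import Literature.Analysis.FluidPDE.SelfSimilarLiouville
import Literature.Analysis.FluidPDE.ChaeWolfRemovingDSS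
import HarnessLib

/-!
# Strategist sketch s21-g5 (family `-s`, INDEPENDENT census) for crux
# `QuantisedSymmetry.PolyhedralDssProfileExists` (stmt-NavierStokesRegularity-1404)

Typed record of the attempts made in `STRATEGY-CENSUS-s21.md` (same crux directory).  Every
`theorem` below is kernel-checked (no `sorry`); every `def … : Prop` is a TARGET / PIECE / S⁺ that is
stated only (nothing is claimed about it beyond the proved arrows).

Sections:
* A. WEAKER INTERMEDIATES below the crux X⁻ and the arrows `X⁻ → W → ¬NavierStokesRegularity`
  that are already tree theorems (so replacing X⁻ by W does not leave the summit);
  the first non-summit-bearing shadow `W4 = ¬PolyhedralTypeILiouville`.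
* B. DECOMPOSITION (β): approximate polyhedral cells + compactness, assembly proved (modus ponens).
* B'. DECOMPOSITION (γ): the abstract Newton–Kantorovich lemma (provable) — the certificate piece is
  described in the census only (no functional setting for the cell map is typed in the tree).
* C. STRENGTHENINGS S⁺ ⇒ X⁻ (mirror class; steady = self-similar; near-identity factor) with the
  one-line arrows, and the named facts that empty the last two.
* D. NEGATION targets (pointers only: the kill switch is the route item `PolyhedralTypeILiouville`).
-/

set_option linter.dupNamespace false
set_option linter.unusedVariables false

namespace Summit.NavierStokesRegularity.NavierStokesRegularity.Cruxes.PolyhedralDssProfileExists.StrategistS21g5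

open MeasureTheory Set
open Literature.Analysis.FluidPDE
open _root_.Summit.NavierStokesRegularity.NavierStokesRegularity.Theses

local notation "E3" => EuclideanSpace ℝ (Fin 3)

/-- The polyhedral clauses on a subgroup `G ≤ O(3)`: finite, proper rotations, irreducible on ℝ³. -/
def IsPolyhedral (G : Subgroup (E3 ≃ₗᵢ[ℝ] E3)) : Prop :=
  Finite G ∧ (∀ g ∈ G, LinearMap.det (g.toLinearEquiv : E3 →ₗ[ℝ] E3) = 1) ∧
    (∀ V : Submodule ℝ E3, (∀ g ∈ G, ∀ v ∈ V, g v ∈ V) → V = ⊥ ∨ V = ⊤)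

/-- A Type-I `c`-DSS nontrivial ancient mild profile (the analytic clauses of X⁻, no group). -/
def IsTypeIDssProfile (c : ℝ) (u : ℝ → E3 → E3) : Prop :=
  IsAncientMildSolution 1 u ∧ (∀ t < 0, AEStronglyMeasurable (u t) volume) ∧
    IsDiscretelySelfSimilar c u ∧ (∃ C₀ : ℝ, HasTypeIDecay C₀ u) ∧ ¬ (∀ t < 0, u t =ᵐ[volume] 0)

/-- The crux, re-displayed through the two predicates (proved equal to the route decl below). -/
theorem crux_iff :
    QuantisedSymmetry.PolyhedralDssProfileExists ↔
      ∃ G : Subgroup (E3 ≃ₗᵢ[ℝ] E3), IsPolyhedral G ∧ ∃ c : ℝ, 1 < c ∧ ∃ u : ℝ → E3 → E3,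
        IsTypeIDssProfile c u ∧ (∀ g ∈ G, ∀ t x, u t (g x) = g (u t x)) := by
  constructor
  · rintro ⟨G, hfin, hdet, hirr, c, hc, u, hanc, hmeas, hdss, hdec, heqv, hnt⟩
    exact ⟨G, ⟨hfin, hdet, hirr⟩, c, hc, u, ⟨hanc, hmeas, hdss, hdec, hnt⟩, heqv⟩
  · rintro ⟨G, ⟨hfin, hdet, hirr⟩, c, hc, u, ⟨hanc, hmeas, hdss, hdec, hnt⟩, heqv⟩
    exact ⟨G, hfin, hdet, hirr, c, hc, u, hanc, hmeas, hdss, hdec, heqv, hnt⟩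

/-! ## A. Weaker intermediates -/

/-- **W1** (drop the sector): a Type-I `λ`-DSS nontrivial ancient mild profile exists for some `λ>1`.
This is the first conjunct of `Blowup.BlowupTypeIDssProfile` (stmt-0155) negated at one factor. -/
def SectorFreeDssProfileExists : Prop :=
  ∃ c : ℝ, 1 < c ∧ ∃ u : ℝ → E3 → E3, IsTypeIDssProfile c u

/-- **W2** (allow a rotation): the antecedent of `FilamentSkeletonRss.RdssProfileTruncation`
(stmt-11289), letter for letter. -/
def RdssProfileExists : Prop :=
  ∃ (c : ℝ) (R : E3 ≃ₗᵢ[ℝ] E3) (u : ℝ → E3 → E3), 1 < c ∧ IsAncientMildSolution 1 u ∧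
    (∀ t < 0, AEStronglyMeasurable (u t) volume) ∧ IsRotatedDSS c R u ∧
      (∃ C₀ : ℝ, HasTypeIDecay C₀ u) ∧ ¬ (∀ t < 0, u t =ᵐ[volume] 0)

/-- **W4** (drop DSS, keep the sector: the first NON-summit-bearing shadow): a nontrivial BOUNDED
ancient mild solution with Type-I decay, equivariant under a polyhedral group — i.e. the negation of
the route's kill switch `PolyhedralTypeILiouville` (stmt-1405). -/
def PolyhedralTypeIAncientExists : Prop := ¬ QuantisedSymmetry.PolyhedralTypeILiouville

/-- **W5** (drop DSS and the sector): a nontrivial bounded ancient mild solution with Type-I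
space–time decay exists (negation of the Type-I-weakened KNSS Liouville statement). -/
def TypeIAncientExists : Prop :=
  ∃ u : ℝ → E3 → E3, IsBoundedAncientMildSolution 1 u ∧ (∀ t < 0, AEStronglyMeasurable (u t) volume) ∧
    (∃ C₀ : ℝ, HasTypeIDecay C₀ u) ∧ ¬ (∀ t < 0, u t =ᵐ[volume] 0)

/-- X⁻ ⇒ W1 (forget `G`). -/
theorem crux_imp_sectorFree :
    QuantisedSymmetry.PolyhedralDssProfileExists → SectorFreeDssProfileExists := by
  rintro ⟨G, -, -, -, c, hc, u, hanc, hmeas, hdss, hdec, -, hnt⟩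
  exact ⟨c, hc, u, hanc, hmeas, hdss, hdec, hnt⟩

/-- W1 ⇔ "Tsai's Type-I `λ`-DSS Liouville statement fails at some `λ > 1`". -/
theorem sectorFree_iff_exists_not_typeIDSSLiouville :
    SectorFreeDssProfileExists ↔ ∃ c : ℝ, 1 < c ∧ ¬ TypeIDSSLiouville c := by
  constructor
  · rintro ⟨c, hc, u, hanc, hmeas, hdss, hdec, hnt⟩
    exact ⟨c, hc, fun hL => hnt (hL hc u hanc hmeas hdss hdec)⟩
  · rintro ⟨c, hc, hL⟩
    by_contra hne
    apply hL
    intro _ u hanc hmeas hdss hdec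
    by_contra hnt
    exact hne ⟨c, hc, u, hanc, hmeas, hdss, hdec, hnt⟩

/-- W1 ⇒ stmt-0155 (`Blowup.BlowupTypeIDssProfile`). -/
theorem sectorFree_imp_blowupTypeIDssProfile :
    SectorFreeDssProfileExists → Blowup.BlowupTypeIDssProfile := by
  intro h
  obtain ⟨c, -, hc⟩ := sectorFree_iff_exists_not_typeIDSSLiouville.mp h
  dsimp only [Blowup.BlowupTypeIDssProfile]
  exact fun hL => hc (hL c).1

/-- W1 ⇒ W2 (the trivial rotation). -/
theorem sectorFree_imp_rdss : SectorFreeDssProfileExists → RdssProfileExists := by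
  rintro ⟨c, hc, u, hanc, hmeas, hdss, hdec, hnt⟩
  exact ⟨c, LinearIsometryEquiv.refl ℝ E3, u, hc, hanc, hmeas, isRotatedDSS_refl_iff.mpr hdss, hdec, hnt⟩

/-- W2 ⇒ X5a (`Blowup.BlowupExists`): the PROVED truncation bridge of route FilamentSkeletonRss. -/
theorem rdss_imp_blowupExists : RdssProfileExists → Blowup.BlowupExists := fun h =>
  _root_.Summit.NavierStokesRegularity.NavierStokesRegularity.Theorems.filamentSkeletonRss_rdssProfileTruncation_proof h

/-- X5a ⇒ ¬NSR: route Blowup's deciding theorem with its proved uniqueness input. -/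
theorem blowupExists_imp_not_nsr : Blowup.BlowupExists → ¬ _root_.NavierStokesRegularity := fun h =>
  Blowup.closes h Blowup.BlowupClayUniqueness_holds

/-- Hence W1 — the weakest DSS-type intermediate below X⁻ — STILL decides the summit. -/
theorem sectorFree_imp_not_nsr : SectorFreeDssProfileExists → ¬ _root_.NavierStokesRegularity :=
  fun h => blowupExists_imp_not_nsr (rdss_imp_blowupExists (sectorFree_imp_rdss h))

/-- … and so does W2. -/
theorem rdss_imp_not_nsr : RdssProfileExists → ¬ _root_.NavierStokesRegularity :=
  fun h => blowupExists_imp_not_nsr (rdss_imp_blowupExists h)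

/-- Sanity re-derivation: X⁻ ⇒ ¬NSR through the ladder (agrees with the route's `closes`). -/
theorem crux_imp_not_nsr :
    QuantisedSymmetry.PolyhedralDssProfileExists → ¬ _root_.NavierStokesRegularity :=
  fun h => sectorFree_imp_not_nsr (crux_imp_sectorFree h)

/-- X⁻ ⇒ W4: contrapositive of the proved route support `LiouvilleKillsProfile` (stmt-1408). -/
theorem crux_imp_polyhedralTypeIAncient :
    QuantisedSymmetry.PolyhedralDssProfileExists → PolyhedralTypeIAncientExists := fun hX hL =>
  _root_.Summit.NavierStokesRegularity.NavierStokesRegularity.Theorems.quantisedSymmetry_liouvilleKillsProfile_proof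
    hL hX

/-- W4 ⇒ W5 (forget `G`). -/
theorem polyhedralTypeIAncient_imp_typeIAncient : PolyhedralTypeIAncientExists → TypeIAncientExists := by
  intro h
  by_contra hne
  apply h
  intro G _ _ _ u hb hmeas hdec _
  by_contra hnt
  exact hne ⟨u, hb, hmeas, hdec, hnt⟩

/-! ## B. Decomposition (β): approximate cells + compactness

Piece 1 `ApproxCellsExist`: for ONE polyhedral `G`, one factor `c`, a Type-I constant `C` and a slice
floor `m > 0`, there are, for every `ε > 0`, FORCED polyhedral DSS cells on the slab
`[-1, -c⁻²] × ℝ³` (mild NS with force `f`, `‖f‖ ≤ ε·(parabolic weight)`) obeying the uniform bounds.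
Piece 2 `CellCompactness`: such a family has an exact limit cell, hence (lead's concatenation,
`Lines/polyhedral_cell.lean`) a profile.  Assembly = modus ponens (trivial seam). -/

/-- A forced polyhedral `c`-DSS cell on the slab `[-1,-c⁻²]` with Type-I constant `C`, `L⁴` slice
floor `m` and forcing level `ε`. -/
def IsForcedPolyhedralCell (G : Subgroup (E3 ≃ₗᵢ[ℝ] E3)) (c C m ε : ℝ)
    (v f : ℝ → E3 → E3) : Prop :=
  (∀ t ∈ Icc (-1 : ℝ) (-(c ^ 2)⁻¹), IsWeaklyDivFree (v t)) ∧
  (∀ s t : ℝ, -1 ≤ s → s < t → t ≤ -(c ^ 2)⁻¹ → IsMildNSSolutionBetween 1 f v s t) ∧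
  AEStronglyMeasurable (Function.uncurry v) (volume.restrict (Icc (-1 : ℝ) (-(c ^ 2)⁻¹) ×ˢ univ)) ∧
  (∀ x, v (-(c ^ 2)⁻¹) x = c • v (-1) (c • x)) ∧
  (∀ g ∈ G, ∀ t ∈ Icc (-1 : ℝ) (-(c ^ 2)⁻¹), ∀ x, v t (g x) = g (v t x)) ∧
  (∀ t ∈ Icc (-1 : ℝ) (-(c ^ 2)⁻¹), ∀ x, ‖v t x‖ ≤ C / (‖x‖ + Real.sqrt (-t))) ∧
  ENNReal.ofReal m ≤ eLpNorm (v (-1)) 4 volume ∧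
  (∀ t ∈ Icc (-1 : ℝ) (-(c ^ 2)⁻¹), ∀ x, ‖f t x‖ ≤ ε / (‖x‖ + Real.sqrt (-t)) ^ 3)

/-- **Piece 1 (β)**: approximate polyhedral cells with uniform Type-I bound and slice floor. -/
def ApproxCellsExist : Prop :=
  ∃ G : Subgroup (E3 ≃ₗᵢ[ℝ] E3), IsPolyhedral G ∧ ∃ c : ℝ, 1 < c ∧ ∃ C m : ℝ, 0 < m ∧
    ∀ ε > 0, ∃ v f : ℝ → E3 → E3, IsForcedPolyhedralCell G c C m ε v f

/-- **Piece 2 (β)**: compactness/concatenation — a uniformly Type-I, non-collapsing family of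
`ε`-forced cells has an exact nontrivial cell, hence a profile. (Provable in principle: forced
ε-regularity in the Type-I class, Arzelà–Ascoli on compacts, Chae–Wolf Thm 1.1 tail, and the
lead's `PolyhedralDssProfileExists_of`.) -/
def CellCompactness : Prop := ApproxCellsExist → QuantisedSymmetry.PolyhedralDssProfileExists

/-- Assembly of (β): proved — and a TRIVIAL SEAM (flag `trivial_seam`): the content sits in the
two pieces, and given Piece 2, Piece 1 is equivalent to the crux (exact cells are 0-forced cells). -/
theorem crux_of_beta : ApproxCellsExist → CellCompactness → QuantisedSymmetry.PolyhedralDssProfileExists :=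
  fun h₁ h₂ => h₂ h₁

/-! ## B'. Decomposition (γ): Newton–Kantorovich split (certificate ∧ NK-lemma)

Only the ABSTRACT lemma is typable today; it is a theorem of functional analysis (Banach fixed
point), recorded as a `Prop` so the census can point at its exact shape.  The CERTIFICATE piece —
an approximate polyhedral DSS cell `v₀` in a Banach space `Y` on which the cell map
`F(V) = V + 𝔅(V,V)` (EVENMAP-PROTOCOL) is `C¹` with `‖F(v₀)‖ ≤ r`, `‖DF(v₀)⁻¹‖ ≤ K` modulo the
orbit phase, `2KLr < 1` — has no candidate `v₀` in print or in the crux directory. -/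

/-- Abstract Newton–Kantorovich / quantitative inverse-function statement on a real Banach space. -/
def AbstractNewtonKantorovich : Prop :=
  ∀ (Y : Type) [NormedAddCommGroup Y] [NormedSpace ℝ Y] [CompleteSpace Y]
    (F : Y → Y) (A : Y ≃L[ℝ] Y) (y₀ : Y) (r K L : ℝ), 0 ≤ r → 0 < K → 0 ≤ L →
    ‖F y₀‖ ≤ r → ‖(A.symm : Y →L[ℝ] Y)‖ ≤ K →
    (∀ y ∈ Metric.closedBall y₀ (2 * K * r), ∀ z ∈ Metric.closedBall y₀ (2 * K * r),
        ‖(F y - F z) - A (y - z)‖ ≤ L * ‖y - z‖) →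
    2 * K * L ≤ 1 → ∃ y ∈ Metric.closedBall y₀ (2 * K * r), F y = 0

/-! ## C. Strengthenings S⁺ ⇒ X⁻ -/

/-- **S⁺1 (mirror class)**: the profile is equivariant under a finite group `H ≤ O(3)` containing an
IMPROPER element and a polyhedral (rotation) subgroup `G ≤ H` — the Kida/Pelz high-symmetry class
(`T_d`, `O_h`, `I_h`). -/
def MirrorPolyhedralDssProfileExists : Prop :=
  ∃ G H : Subgroup (E3 ≃ₗᵢ[ℝ] E3), IsPolyhedral G ∧ G ≤ H ∧ Finite H ∧
    (∃ h ∈ H, LinearMap.det (h.toLinearEquiv : E3 →ₗ[ℝ] E3) = -1) ∧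
    ∃ c : ℝ, 1 < c ∧ ∃ u : ℝ → E3 → E3, IsTypeIDssProfile c u ∧ (∀ h ∈ H, ∀ t x, u t (h x) = h (u t x))

theorem mirror_imp_crux : MirrorPolyhedralDssProfileExists → QuantisedSymmetry.PolyhedralDssProfileExists := by
  rintro ⟨G, H, hG, hGH, -, -, c, hc, u, hu, heqv⟩
  exact crux_iff.mpr ⟨G, hG, c, hc, u, hu, fun g hg t x => heqv g (hGH hg) t x⟩

/-- **S⁺2 (steady in similarity variables = self-similar, i.e. DSS for every factor)**. -/
def SteadyPolyhedralProfileExists : Prop :=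
  ∃ G : Subgroup (E3 ≃ₗᵢ[ℝ] E3), IsPolyhedral G ∧ ∃ u : ℝ → E3 → E3,
    (∀ c : ℝ, 1 < c → IsTypeIDssProfile c u) ∧ (∀ g ∈ G, ∀ t x, u t (g x) = g (u t x))

theorem steady_imp_crux : SteadyPolyhedralProfileExists → QuantisedSymmetry.PolyhedralDssProfileExists := by
  rintro ⟨G, hG, u, hu, heqv⟩
  exact crux_iff.mpr ⟨G, hG, 2, by norm_num, u, hu 2 (by norm_num), heqv⟩

/-- S⁺2 is EMPTY modulo regularity bookkeeping: the refutation target, keyed to the named fact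
`tsai_selfsimilar` (Tsai 1998 Thm 1; a Type-I self-similar slice `|U(y)| ≤ C₀/(1+|y|)` is in `L^q`,
`3 < q < ∞`).  Stated, not proved here (the mild → Leray-profile-system passage is the bookkeeping). -/
def SteadyRefutationTarget : Prop := tsai_selfsimilar → ¬ SteadyPolyhedralProfileExists

/-- **S⁺3 (near-identity factor)**: a profile whose factor lies below the Chae–Wolf threshold
`c₁(C₀)` of its own Type-I constant.  EMPTY by `chaeWolf2017_removing_dss` (Thm 1.3) modulo
classical regularity of Type-I ancient mild solutions — exactly the lead's landed necessary condition
`stub_periodWindow` (Theorems/QuantisedSymmetryPolyhedralDssProfileExistsStubPeriodWindow.lean). -/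
def NearIdentityRefutationTarget : Prop :=
  chaeWolf2017_removing_dss → ∀ C₀ : ℝ, 0 < C₀ → ∃ c₁ : ℝ, 1 < c₁ ∧
    ∀ G : Subgroup (E3 ≃ₗᵢ[ℝ] E3), IsPolyhedral G → ∀ c : ℝ, 1 < c → c < c₁ → ∀ u : ℝ → E3 → E3,
      IsAncientMildSolution 1 u → (∀ t < 0, AEStronglyMeasurable (u t) volume) →
        IsDiscretelySelfSimilar c u → HasTypeIDecay C₀ u → (∀ g ∈ G, ∀ t x, u t (g x) = g (u t x)) →
          ∀ t < 0, u t =ᵐ[volume] 0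

/-- **S⁺4 (nondegenerate cell)** is S⁺ of kind (γ): X⁻ plus invertibility of the linearised cell map
modulo the orbit phase.  Not typable without the functional setting; see census §Strengthen. -/
def NondegenerateCellNote : Prop := True

/-! ## D. Negation

The negation of X⁻ restricted to the route's class is the route item `PolyhedralTypeILiouville`
(stmt-1405, open).  The landed partial negations are the lead's necessary conditions
(`stub_periodWindow`, `stub_noSmallConstant`, `stub_notAxisymmetric`, `stub_ancientDuhamel`,
`stub_gaussianEnergyIdentity`, …, all `--supports stmt-1404`).  The arrow that would END the crux: -/
theorem kill_switch :
    QuantisedSymmetry.PolyhedralTypeILiouville → ¬ QuantisedSymmetry.PolyhedralDssProfileExists :=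
  _root_.Summit.NavierStokesRegularity.NavierStokesRegularity.Theorems.quantisedSymmetry_liouvilleKillsProfile_proof

end Summit.NavierStokesRegularity.NavierStokesRegularity.Cruxes.PolyhedralDssProfileExists.StrategistS21g5
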